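import Literature.Topology.FourManifolds.CircleMapWinding
import HarnessLib

/-!
# Winding numbers along a loop are invariant under homotopies of the map

Continuation of `CircleMapWinding.lean` (winding numbers `winding F γ ∈ ℤ` of a circle-valued map
`F : Y → S¹` along a loop `γ`). For a loop `ℓ` at `x₀` in `X`, a circle-valued `F` on `Y` and
HOMOTOPIC maps `Φ₀ ≃ Φ₁ : X → Y`,

* `CircleMaps.winding_map_eq_of_homotopy` — `winding F (Φ₀ ∘ ℓ) = winding F (Φ₁ ∘ ℓ)`:
  the loops `F ∘ Φₛ ∘ ℓ` (base points moving with `s`) all have the same winding number.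

Proof (Hatcher 2002, §1.1, proof of Thm. 1.7 / Prop. 1.30, the homotopy lifting property of
`exp : ℝ → S¹`, Mathlib's `IsCoveringMap.liftHomotopy`): lift `(s, t) ↦ F (H (s, ℓ t))` to a
continuous `L : I × I → ℝ`; then `s ↦ winding F (Φₛ ∘ ℓ) = (L (s,1) - L (s,0)) / 2π` is a continuous
integer-valued function on the connected interval, hence constant. (For homotopies fixing the
base point this is `winding_eq_of_homotopic`; here the base point may move.) This is the step
"a homotopy equivalence `P ≃ₕ S¹ × S³` carries the standard generator to a loop of winding
number one" used to identify the connected infinite cyclic cover of such a `P`.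

Everything is proved; no definitions, no named facts.

## References

* A. Hatcher, *Algebraic Topology*, CUP (2002), §1.1 Thm. 1.7 and Prop. 1.30 (homotopy lifting
  for `ℝ → S¹`). [HatcherAT2002]
-/

noncomputable section

open Set Function
open scoped unitInterval Real Topology

namespace Literature.Topology.FourManifolds

namespace CircleMaps

variable {X Y : Type*} [TopologicalSpace X] [TopologicalSpace Y]

/-- The loop `ℓ` pushed forward by the time-`s` map of a homotopy `H`. [folklore] -/
theorem continuous_homotopy_curry {Φ₀ Φ₁ : C(X, Y)} (H : Φ₀.Homotopy Φ₁) (s : I) :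
    Continuous fun x ↦ H (s, x) :=
  H.continuous.comp (Continuous.prodMk_right s)

/-- **Winding numbers along a fixed loop are invariant under homotopies of the map** (Hatcher
2002, Prop. 1.30, homotopy lifting for `exp : ℝ → S¹`): if `Φ₀ ≃ Φ₁ : X → Y` are homotopic,
`ℓ` is a loop in `X` and `F : Y → S¹`, then `winding F (Φ₀ ∘ ℓ) = winding F (Φ₁ ∘ ℓ)`. The lift
`L` of `(s, t) ↦ F (H (s, ℓ t))` makes `s ↦ winding F (Φₛ ∘ ℓ) = (L(s,1) - L(s,0))/2π` a continuous
integer-valued function of `s ∈ [0, 1]`. [cite: HatcherAT2002, Prop. 1.30] -/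
theorem winding_map_eq_of_homotopy (F : C(Y, Circle)) {Φ₀ Φ₁ : C(X, Y)} (H : Φ₀.Homotopy Φ₁)
    {x₀ : X} (ℓ : Path x₀ x₀) :
    winding F (ℓ.map Φ₀.continuous) = winding F (ℓ.map Φ₁.continuous) := by
  -- the two-parameter family of circle points and its lift
  set K : C(I × I, Circle) := ⟨fun p ↦ F (H (p.1, ℓ p.2)), by fun_prop⟩ with hK
  set f0 : C(I, ℝ) := liftOf F (ℓ.map Φ₀.continuous) with hf0
  have hK0 : ∀ t, K (0, t) = Circle.exp (f0 t) := fun t ↦ by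
    show F (H (0, ℓ t)) = Circle.exp (liftOf F (ℓ.map Φ₀.continuous) t)
    rw [exp_liftOf, H.apply_zero]
    rfl
  set L : C(I × I, ℝ) := Circle.isCoveringMap_exp.liftHomotopy K f0 hK0 with hL
  have hLK : ∀ s t, Circle.exp (L (s, t)) = F (H (s, ℓ t)) := fun s t ↦
    congr_fun (Circle.isCoveringMap_exp.liftHomotopy_lifts K f0 hK0) (s, t)
  -- the loops at time `s` and their winding numbers
  set n : I → ℤ := fun s ↦ winding F (ℓ.map (continuous_homotopy_curry H s)) with hn
  have hincr : ∀ s, (n s : ℝ) * (2 * π) = L (s, 1) - L (s, 0) := fun s ↦ by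
    rw [← incr_eq_winding, incr_eq_of_lift F (ℓ.map (continuous_homotopy_curry H s))
      (G := fun t ↦ L (s, t)) (L.continuous.comp (Continuous.prodMk_right s)) (fun t ↦ hLK s t)]
  -- `n` is continuous, hence constant
  have hcontR : Continuous fun s ↦ (n s : ℝ) := by
    have h : (fun s ↦ (n s : ℝ)) = fun s ↦ (L (s, 1) - L (s, 0)) / (2 * π) := by
      funext s
      rw [← hincr s, mul_div_cancel_right₀ _ (by positivity : (2 * π : ℝ) ≠ 0)]
    rw [h]
    fun_prop
  have hcont : Continuous n := (Int.isClosedEmbedding_coe_real.continuous_iff).2 hcontR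
  have hconst : n 0 = n 1 := PreconnectedSpace.constant inferInstance hcont
  -- the end loops are the given ones
  have h0 : n 0 = winding F (ℓ.map Φ₀.continuous) :=
    winding_congr F F _ _ fun t ↦ by
      show F (H (0, ℓ t)) = F (Φ₀ (ℓ t))
      rw [H.apply_zero]
  have h1 : n 1 = winding F (ℓ.map Φ₁.continuous) :=
    winding_congr F F _ _ fun t ↦ by
      show F (H (1, ℓ t)) = F (Φ₁ (ℓ t))
      rw [H.apply_one]
  rw [← h0, ← h1, hconst]

/-- **Homotopic maps have the same winding numbers along every loop** (`Homotopic` form).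
[cite: HatcherAT2002, Prop. 1.30] -/
theorem winding_map_eq_of_homotopic (F : C(Y, Circle)) {Φ₀ Φ₁ : C(X, Y)} (h : Φ₀.Homotopic Φ₁)
    {x₀ : X} (ℓ : Path x₀ x₀) :
    winding F (ℓ.map Φ₀.continuous) = winding F (ℓ.map Φ₁.continuous) :=
  winding_map_eq_of_homotopy F h.some ℓ

/-- **Winding numbers of pulled-back maps along pushed-forward loops**:
`winding (F ∘ Φ) ℓ = winding F (Φ ∘ ℓ)`. [folklore] -/
theorem winding_comp_eq_winding_map (F : C(Y, Circle)) (Φ : C(X, Y)) {x₀ : X} (ℓ : Path x₀ x₀) :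
    winding (F.comp Φ) ℓ = winding F (ℓ.map Φ.continuous) :=
  winding_congr _ _ _ _ fun _ ↦ rfl

end CircleMaps

end Literature.Topology.FourManifolds
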